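import Mathlib
import Literature.Analysis.ValidatedNumerics.AffineArithmetic
import Literature.Analysis.ValidatedNumerics.AffineArithmeticInv
import Literature.Analysis.ValidatedNumerics.IntervalLogArctan
import HarnessLib

/-!
# ζ(5) search — BARRIER: CRITICAL VALUES ON BOXES — kernel arithmetic II: the logarithm of an affine form

HONEST FRAMING (cell `pub-zeta5`): systematic search; no irrationality claim unless kernel-certified. Problem-independent
kernel ARITHMETIC (theory seat cert-2 g37, item «CRITICAL VALUES ON BOXES — KERNEL»): the natural logarithm on a
POSITIVE affine form of the tree's fixed-point affine arithmetic (`Literature.Analysis.ValidatedNumerics.AForm`,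
de Figueiredo–Stolfi; the tree has `add`/`mul`/`inv`, not `log`): tangent form at the centre,
`log x·S = S·log(m/S) + (S/m)·D + S·(log(1+u) − u)`, `|log(1+u) − u| ≤ u²/(1 − |u|)` (Mathlib's
`Real.abs_log_sub_add_sum_range_le`), the constant `log(m/S)` enclosed by the tree's `MI.logScaled`; `AFormLog.log`
with the inclusion theorem `mem_log`, and `logAbs` (`log |x|` on a sign-definite form) with `mem_logAbs` (which also
returns `x ≠ 0`). Nothing about Brown–Zudilin's objects, any γ, C2 (OPEN), S-E or `ζ(5)`.
-/

open Finset

namespace Summit.KontsevichZagierPeriods.Zeta5Search.Barrier.ConeGamma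

/-! ## The logarithm of a positive affine form -/

namespace AFormLog

open Literature.Analysis.ValidatedNumerics
open Literature.Analysis.ValidatedNumerics.AForm
open Literature.Analysis.ValidatedNumerics.NumericsMP

/-- Number of series terms used for the constant `log(m/S)` (tree's `MI.logScaled`). -/
def KLOG : ℕ := 70

/-- `log` on a POSITIVE affine form at scale `S` (`none` unless `rad F < c` and the constant encloses): with
`m = c`, `ρ = rad F`, `X = x·S = m + D`, `D = A + e`: `log x · S = S·log(m/S) + (S/m)D + S(log(1+D/m) − D/m)`,
`|log(1+u) − u| ≤ u²/(1−|u|)`; centre = midpoint of the `MI.logScaled` enclosure of `log(m/S)`, coefficients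
`⌊S a_j/m⌋`, radius `⌈S r/m + S ρ²/(m(m−ρ))⌉ + (width of the constant)/2 + 2 + |a|`. -/
def log (S : ℕ) (F : AForm) : Option AForm :=
  if (rad F : ℤ) < F.c then
    match MI.logScaled S KLOG F.c with
    | some L => some
        ⟨(L.lo + L.hi) / 2,
         F.a.map (fun b : ℤ => ⌊(S : ℚ) * b / (F.c : ℚ)⌋),
         ⌈(S : ℚ) * F.r / (F.c : ℚ) + (S : ℚ) * (rad F : ℚ) ^ 2 / ((F.c : ℚ) * ((F.c : ℚ) - rad F))⌉₊
           + ((L.hi - L.lo) / 2).toNat + 2 + F.a.length⟩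
    | none => none
  else none

/-- `log |x|` on a sign-definite form: `log F` if positive, `log (−F)` if negative. -/
def logAbs (S : ℕ) (F : AForm) : Option AForm :=
  if (rad F : ℤ) < F.c then log S F else if (rad F : ℤ) < -F.c then log S (neg F) else none

variable {S : ℕ} {ε : ℕ → ℝ} {x : ℝ} {F : AForm}

/-- `log` answers only on forms with `rad F < c`. -/
theorem rad_lt_of_log {G : AForm} (h : log S F = some G) : (rad F : ℤ) < F.c := by
  unfold log at h; split_ifs at h with hlt; exact hlt

/-- `|log(1+u) − u| ≤ u²/(1 − |u|)` for `|u| < 1`. -/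
theorem abs_log_one_add_sub_le {u : ℝ} (hu : |u| < 1) : |Real.log (1 + u) - u| ≤ u ^ 2 / (1 - |u|) := by
  have h := Real.abs_log_sub_add_sum_range_le (x := -u) (by rwa [abs_neg]) 1
  simp only [Finset.sum_range_one, Nat.cast_zero, zero_add, pow_one, div_one, sub_neg_eq_add] at h
  rw [abs_neg] at h
  have e : -u + Real.log (1 + u) = Real.log (1 + u) - u := by ring
  rw [e] at h
  simpa [neg_sq] using h

/-- **Inclusion theorem of the affine logarithm.** -/
theorem mem_log (hS : 0 < S) (hε : AForm.Valid ε) {G : AForm} (hG : log S F = some G) (hx : AForm.mem S ε x F) :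
    AForm.mem S ε (Real.log x) G := by
  have hlt := rad_lt_of_log hG
  have hx0 : 0 < x := pos_of_rad_lt hS hε hlt hx
  have hrad := abs_le.1 (abs_sub_le_rad hε hx)
  unfold log at hG
  rw [if_pos hlt] at hG
  split at hG
  · rename_i L hL
    rw [Option.some.injEq] at hG
    subst hG
    simp only [AForm.mem] at hx ⊢
    have hSr : (0 : ℝ) < S := by exact_mod_cast hS
    have hρm : ((rad F : ℕ) : ℝ) < F.c := by exact_mod_cast hlt
    have hρ0 : (0 : ℝ) ≤ rad F := Nat.cast_nonneg _
    have hm : (0 : ℝ) < F.c := by linarith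
    obtain ⟨e, he⟩ : ∃ e, x * S = F.c + lin ε F.a + e := ⟨x * S - (F.c + lin ε F.a), by ring⟩
    have he' : |e| ≤ F.r := by convert hx using 2; linarith
    -- the constant `log (m/S)`
    obtain ⟨_, hL1, hL2⟩ := MI.mem_logScaled hS hL
    -- decomposition
    set D : ℝ := x * S - F.c with hD
    set u : ℝ := D / F.c with hu
    have hDle : |D| ≤ rad F := abs_le.2 ⟨by linarith [hrad.1], by linarith [hrad.2]⟩
    have hu_lt : |u| < 1 := by
      rw [hu, abs_div, abs_of_pos hm, div_lt_one hm]; linarith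
    have hu_le : |u| ≤ (rad F : ℝ) / F.c := by
      rw [hu, abs_div, abs_of_pos hm]; exact div_le_div_of_nonneg_right hDle hm.le
    have hxS : x = ((F.c : ℝ) / S) * (1 + u) := by
      rw [hu, hD]; field_simp; ring
    have h1u : 0 < 1 + u := by
      have := (abs_lt.1 hu_lt).1; linarith
    have hlogx : Real.log x = Real.log ((F.c : ℝ) / S) + Real.log (1 + u) := by
      rw [hxS, Real.log_mul (by positivity) h1u.ne']
    -- second-order remainder
    have hrem : |Real.log (1 + u) - u| ≤ (rad F : ℝ) ^ 2 / ((F.c : ℝ) * ((F.c : ℝ) - rad F)) := by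
      refine (abs_log_one_add_sub_le hu_lt).trans ?_
      have h1 : u ^ 2 ≤ ((rad F : ℝ) / F.c) ^ 2 := by
        rw [← sq_abs]; exact pow_le_pow_left₀ (abs_nonneg _) hu_le 2
      have h2 : 1 - (rad F : ℝ) / F.c ≤ 1 - |u| := by linarith
      have h3 : 0 < 1 - (rad F : ℝ) / F.c := by rw [sub_pos, div_lt_one hm]; exact hρm
      calc u ^ 2 / (1 - |u|) ≤ ((rad F : ℝ) / F.c) ^ 2 / (1 - (rad F : ℝ) / F.c) :=
            div_le_div₀ (by positivity) h1 h3 h2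
        _ = (rad F : ℝ) ^ 2 / ((F.c : ℝ) * ((F.c : ℝ) - rad F)) := by
            field_simp
    -- the pieces of the error
    have hcen : |(S : ℝ) * Real.log ((F.c : ℝ) / S) - (((L.lo + L.hi) / 2 : ℤ) : ℝ)|
        ≤ ((((L.hi - L.lo) / 2).toNat : ℕ) : ℝ) + 2 := by
      have hw : (((L.hi - L.lo) / 2 : ℤ) : ℝ) ≤ ((((L.hi - L.lo) / 2).toNat : ℕ) : ℝ) := by
        exact_mod_cast Int.self_le_toNat _
      have hmid1 : (((L.lo + L.hi) / 2 : ℤ) : ℝ) * 2 ≤ (L.lo : ℝ) + L.hi := by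
        exact_mod_cast Int.ediv_mul_le (L.lo + L.hi) two_ne_zero
      have hmid2 : (L.lo : ℝ) + L.hi < ((((L.lo + L.hi) / 2 : ℤ) : ℝ) + 1) * 2 := by
        exact_mod_cast Int.lt_ediv_add_one_mul_self (L.lo + L.hi) (by norm_num : (0:ℤ) < 2)
      have hhalf : (L.hi : ℝ) - L.lo < ((((L.hi - L.lo) / 2 : ℤ) : ℝ) + 1) * 2 := by
        exact_mod_cast Int.lt_ediv_add_one_mul_self (L.hi - L.lo) (by norm_num : (0:ℤ) < 2)
      rw [mul_comm] at hL1 hL2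
      rw [abs_le]; constructor <;> linarith
    have hlin : |((S : ℝ) / F.c) * lin ε F.a - lin ε (F.a.map fun b : ℤ => ⌊(S : ℚ) * b / (F.c : ℚ)⌋)|
        ≤ F.a.length := by
      rw [abs_sub_comm]
      exact abs_lin_map_sub_le (g := fun b : ℤ => ⌊(S : ℚ) * b / (F.c : ℚ)⌋) (t := (S : ℝ) / F.c)
        (fun b => abs_floor_sub_le _ (by push_cast; ring)) hε F.a
    have hceil : (S : ℝ) * F.r / F.c + (S : ℝ) * (rad F : ℝ) ^ 2 / ((F.c : ℝ) * ((F.c : ℝ) - rad F))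
        ≤ ((⌈(S : ℚ) * F.r / (F.c : ℚ) + (S : ℚ) * (rad F : ℚ) ^ 2 / ((F.c : ℚ) * ((F.c : ℚ) - rad F))⌉₊ : ℕ) : ℝ) :=
      le_natCeil _ (by push_cast; ring)
    have he2 : |((S : ℝ) / F.c) * e| ≤ (S : ℝ) * F.r / F.c := by
      rw [abs_mul, abs_of_pos (by positivity)]
      calc (S : ℝ) / F.c * |e| ≤ (S : ℝ) / F.c * F.r := mul_le_mul_of_nonneg_left he' (by positivity)
        _ = (S : ℝ) * F.r / F.c := by ring
    have hrem' : |(S : ℝ) * (Real.log (1 + u) - u)| ≤ (S : ℝ) * (rad F : ℝ) ^ 2 / ((F.c : ℝ) * ((F.c : ℝ) - rad F)) := by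
      rw [abs_mul, abs_of_pos hSr, mul_div_assoc]
      exact mul_le_mul_of_nonneg_left hrem hSr.le
    -- assemble
    have hDu : (S : ℝ) / F.c * D = S * u := by rw [hu]; field_simp
    have eq : Real.log x * S - ((((L.lo + L.hi) / 2 : ℤ) : ℝ) + lin ε (F.a.map fun b : ℤ => ⌊(S : ℚ) * b / (F.c : ℚ)⌋))
        = ((S : ℝ) * Real.log ((F.c : ℝ) / S) - (((L.lo + L.hi) / 2 : ℤ) : ℝ))
          + (((S : ℝ) / F.c) * lin ε F.a - lin ε (F.a.map fun b : ℤ => ⌊(S : ℚ) * b / (F.c : ℚ)⌋))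
          + ((S : ℝ) / F.c) * e + (S : ℝ) * (Real.log (1 + u) - u) := by
      have hD' : D = lin ε F.a + e := by rw [hD, he]; ring
      have h3 : (S : ℝ) * Real.log (1 + u) = S * u + S * (Real.log (1 + u) - u) := by ring
      rw [hlogx, add_mul, mul_comm (Real.log (1 + u)), h3, ← hDu, hD']
      ring
    rw [eq]
    refine (abs_add_le _ _).trans ((add_le_add (abs_add_three _ _ _) hrem').trans ?_)
    push_cast
    linarith [hcen, hlin, he2, hceil]
  · exact absurd hG (by simp)

/-- **`log |x|` on a sign-definite form.** -/
theorem mem_logAbs (hS : 0 < S) (hε : AForm.Valid ε) {G : AForm} (hG : logAbs S F = some G)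
    (hx : AForm.mem S ε x F) : x ≠ 0 ∧ AForm.mem S ε (Real.log |x|) G := by
  unfold logAbs at hG
  split_ifs at hG with h1 h2
  · have hx0 := pos_of_rad_lt hS hε h1 hx
    rw [abs_of_pos hx0]
    exact ⟨hx0.ne', mem_log hS hε hG hx⟩
  · have hxn : AForm.mem S ε (-x) (neg F) := mem_neg hx
    have hradneg : (rad (neg F) : ℤ) < (neg F).c := by
      have hc : (neg F).c = -F.c := by simp [neg, mulInt]
      have key : ∀ l : List ℤ, absSum (l.map (fun x => -1 * x)) = absSum l := by
        intro l
        induction l with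
        | nil => rfl
        | cons b l ih => rw [List.map_cons, absSum, absSum, ih, neg_one_mul, Int.natAbs_neg]
      have hr : rad (neg F) = rad F := by
        simp only [rad, neg, mulInt, Int.natAbs_neg, Int.natAbs_one, one_mul, key]
      rw [hc, hr]; exact h2
    have hx0 := pos_of_rad_lt hS hε hradneg hxn
    rw [abs_of_neg (by linarith)]
    exact ⟨by linarith, mem_log hS hε hG hxn⟩

end AFormLog

end Summit.KontsevichZagierPeriods.Zeta5Search.Barrier.ConeGamma
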